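import Mathlib
import Summits.Ventures.PercRepro2.V2SP
import Summits.Ventures.PercRepro2.Tail2DCount
import Summits.Ventures.PercRepro2.Tail2DThreePoint
import Summits.Ventures.PercRepro2.Tail2DP2Series
import Summits.Ventures.PercRepro2.Tail2DDisjointPaths

/-!
# Anti-diagonal unimodality at the axis: `k+1` disjoint red paths are rarer than `k` disjoint red
paths together with a blue path, for every `k` (seat mine-b, cell pub-perc-repro2)

For every pattern `s` of the cell's series–parallel grammar, uniformly two-coloured, and EVERY `k`,

  `#{r ≥ k+1} ≤ #{r ≥ k ∧ b ≥ 1}`   (`tail_axis_unimodal`),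

i.e. `T(k+1, 0) ≤ T(k, 1)` for the two-colour flow tail — the whole family of registry §34.16 whose
members `k = 1`, `k = 2` are `disjoint_le_conn` and `disjoint3_le_conn2`.

PROOF. The DUAL FORM of the `k`-th inequality is `#{r ≥ k ∧ b = 0} ≤ #{r = k}` (`dual_iff`: split
`{r ≥ k}` by `b = 0` / `b ≥ 1`, and `{r ≥ k} = {r ≥ k+1} ⊔ {r = k}`). Induction over the grammar,
all `k` at once. Atoms: flows are `≤ 1`. Series: in the primal form both sides multiply. Parallel:
partition `{r₁ + r₂ ≥ k, b₁ = b₂ = 0}` by the value `i = r₁ < k` and by `r₁ ≥ k`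
(`card_vt_par`):

  `#{r ≥ k ∧ b = 0}'' = Σ_{i<k} #{r₁ = i, b₁ = 0}·#{r₂ ≥ k−i, b₂ = 0} + #{r₁ ≥ k, b₁ = 0}·#{b₂ = 0}`
  `≤ Σ_{i<k} #{r₁ = i}·#{r₂ = k−i} + #{r₁ = k}·#{r₂ = 0} = #{r = k}''`  (`card_rq_par`),

termwise by `#{r = i, b = 0} ≤ #{r = i}`, the induction hypothesis at level `k − i` for the second
factor, the hypothesis at level `k` for the first, and `#{b = 0} = #{r = 0}` (the colour swap).
-/

namespace Summit.Ventures.PercRepro2.Tail2D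

open V2Closure

section Counts

variable (s : V2Closure.SP)

/-- `#{r ≥ k} = #{r ≥ k ∧ b ≥ 1} + #{r ≥ k ∧ b = 0}` -/
lemma card_rt_split (k : ℕ) :
    (Finset.univ.filter (fun y : s.Conf => k ≤ s.rLab y)).card
      = (Finset.univ.filter (fun y : s.Conf => k ≤ s.rLab y ∧ 1 ≤ s.bLab y)).card
        + (Finset.univ.filter (fun y : s.Conf => k ≤ s.rLab y ∧ s.bLab y = 0)).card := by
  rw [Finset.card_filter, Finset.card_filter, Finset.card_filter, ← Finset.sum_add_distrib]
  refine Finset.sum_congr rfl (fun y _ => ?_)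
  split_ifs <;> omega

/-- `#{r ≥ k} = #{r ≥ k+1} + #{r = k}` -/
lemma card_rt_succ (k : ℕ) :
    (Finset.univ.filter (fun y : s.Conf => k ≤ s.rLab y)).card
      = (Finset.univ.filter (fun y : s.Conf => k + 1 ≤ s.rLab y)).card
        + (Finset.univ.filter (fun y : s.Conf => s.rLab y = k)).card := by
  rw [Finset.card_filter, Finset.card_filter, Finset.card_filter, ← Finset.sum_add_distrib]
  refine Finset.sum_congr rfl (fun y _ => ?_)
  split_ifs <;> omega

/-- the `k`-th inequality and its dual form `#{r ≥ k ∧ b = 0} ≤ #{r = k}` -/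
lemma dual_iff (k : ℕ) :
    (Finset.univ.filter (fun y : s.Conf => k + 1 ≤ s.rLab y)).card
        ≤ (Finset.univ.filter (fun y : s.Conf => k ≤ s.rLab y ∧ 1 ≤ s.bLab y)).card
      ↔ (Finset.univ.filter (fun y : s.Conf => k ≤ s.rLab y ∧ s.bLab y = 0)).card
        ≤ (Finset.univ.filter (fun y : s.Conf => s.rLab y = k)).card := by
  have h1 := card_rt_split s k
  have h2 := card_rt_succ s k
  omega

/-- `#{r = i ∧ b = 0} ≤ #{r = i}` -/
lemma card_wq_le (i : ℕ) :
    (Finset.univ.filter (fun y : s.Conf => s.rLab y = i ∧ s.bLab y = 0)).card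
      ≤ (Finset.univ.filter (fun y : s.Conf => s.rLab y = i)).card :=
  Finset.card_le_card (fun y hy => by simp only [Finset.mem_filter] at hy ⊢; exact ⟨hy.1, hy.2.1⟩)

end Counts

section Product

variable (s t : V2Closure.SP)

/-- series: `#{r ≥ k}` multiplies -/
lemma card_rt_ser (k : ℕ) :
    (Finset.univ.filter (fun y : (V2Closure.SP.ser s t).Conf => k ≤ (V2Closure.SP.ser s t).rLab y)).card
      = (Finset.univ.filter (fun y : s.Conf => k ≤ s.rLab y)).card * (Finset.univ.filter (fun y : t.Conf => k ≤ t.rLab y)).card := by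
  simp only [Finset.card_filter]
  rw [← sum_prod_ite s t (fun a => k ≤ s.rLab a) (fun b => k ≤ t.rLab b)]
  refine Finset.sum_congr rfl (fun y _ => ?_)
  simp only [SP.rLab, serR]
  split_ifs <;> omega

/-- series: `#{r ≥ k ∧ b ≥ 1}` multiplies -/
lemma card_ct_ser (k : ℕ) :
    (Finset.univ.filter (fun y : (V2Closure.SP.ser s t).Conf =>
        k ≤ (V2Closure.SP.ser s t).rLab y ∧ 1 ≤ (V2Closure.SP.ser s t).bLab y)).card
      = (Finset.univ.filter (fun y : s.Conf => k ≤ s.rLab y ∧ 1 ≤ s.bLab y)).card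
        * (Finset.univ.filter (fun y : t.Conf => k ≤ t.rLab y ∧ 1 ≤ t.bLab y)).card := by
  simp only [Finset.card_filter]
  rw [← sum_prod_ite s t (fun a => k ≤ s.rLab a ∧ 1 ≤ s.bLab a) (fun b => k ≤ t.rLab b ∧ 1 ≤ t.bLab b)]
  refine Finset.sum_congr rfl (fun y _ => ?_)
  simp only [SP.rLab, SP.bLab, serR, serB]
  split_ifs <;> omega

/-- parallel: `#{r = k}` is the convolution `Σ_{i ≤ k} #{r₁ = i}·#{r₂ = k − i}` -/
lemma card_rq_par (k : ℕ) :
    (Finset.univ.filter (fun y : (V2Closure.SP.par s t).Conf => (V2Closure.SP.par s t).rLab y = k)).card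
      = ∑ i ∈ Finset.range (k + 1),
          (Finset.univ.filter (fun y : s.Conf => s.rLab y = i)).card * (Finset.univ.filter (fun y : t.Conf => t.rLab y = k - i)).card := by
  change (Finset.univ.filter (fun y : s.Conf × t.Conf => s.rLab y.1 + t.rLab y.2 = k)).card = _
  rw [Finset.card_eq_sum_card_fiberwise (f := fun y : s.Conf × t.Conf => s.rLab y.1) (t := Finset.range (k + 1))
    (fun y hy => by
      have h := (Finset.mem_filter.1 (Finset.mem_coe.1 hy)).2
      exact Finset.mem_range.2 (by show s.rLab y.1 < k + 1; omega))]
  refine Finset.sum_congr rfl (fun i hi => ?_)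
  have hi' : i ≤ k := by simpa only [Finset.mem_range, Nat.lt_succ_iff] using hi
  rw [Finset.filter_filter, Finset.card_filter, Finset.card_filter, Finset.card_filter,
    ← sum_prod_ite s t (fun a => s.rLab a = i) (fun b => t.rLab b = k - i)]
  refine Finset.sum_congr rfl (fun y _ => ?_)
  split_ifs <;> omega

/-- parallel: `#{r ≥ k ∧ b = 0}` partitioned by `r₁ = i < k` and by `r₁ ≥ k` -/
lemma card_vt_par (k : ℕ) :
    (Finset.univ.filter (fun y : (V2Closure.SP.par s t).Conf =>
        k ≤ (V2Closure.SP.par s t).rLab y ∧ (V2Closure.SP.par s t).bLab y = 0)).card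
      = (∑ i ∈ Finset.range k,
          (Finset.univ.filter (fun y : s.Conf => s.rLab y = i ∧ s.bLab y = 0)).card
            * (Finset.univ.filter (fun y : t.Conf => k - i ≤ t.rLab y ∧ t.bLab y = 0)).card)
        + (Finset.univ.filter (fun y : s.Conf => k ≤ s.rLab y ∧ s.bLab y = 0)).card
            * (Finset.univ.filter (fun y : t.Conf => t.bLab y = 0)).card := by
  change (Finset.univ.filter (fun y : s.Conf × t.Conf => k ≤ s.rLab y.1 + t.rLab y.2 ∧ s.bLab y.1 + t.bLab y.2 = 0)).card = _
  rw [Finset.card_eq_sum_card_fiberwise (f := fun y : s.Conf × t.Conf => min (s.rLab y.1) k) (t := Finset.range (k + 1))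
    (fun y _ => Finset.mem_range.2 (by show min (s.rLab y.1) k < k + 1; omega)), Finset.sum_range_succ]
  congr 1
  · refine Finset.sum_congr rfl (fun i hi => ?_)
    have hi' : i < k := Finset.mem_range.1 hi
    rw [Finset.filter_filter, Finset.card_filter, Finset.card_filter, Finset.card_filter,
      ← sum_prod_ite s t (fun a => s.rLab a = i ∧ s.bLab a = 0) (fun b => k - i ≤ t.rLab b ∧ t.bLab b = 0)]
    refine Finset.sum_congr rfl (fun y _ => ?_)
    split_ifs <;> omega
  · rw [Finset.filter_filter, Finset.card_filter, Finset.card_filter, Finset.card_filter,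
      ← sum_prod_ite s t (fun a => k ≤ s.rLab a ∧ s.bLab a = 0) (fun b => t.bLab b = 0)]
    refine Finset.sum_congr rfl (fun y _ => ?_)
    split_ifs <;> omega

end Product

/-- the flows of an atom are `≤ 1` -/
lemma atom_rLab_le_one : ∀ (s : V2Closure.SP), (s = .free ∨ s = .pin ∨ s = .absent) → ∀ y : s.Conf, s.rLab y ≤ 1
  | .free, _, y => by cases y <;> simp [SP.rLab]
  | .pin, _, _ => le_rfl
  | .absent, _, _ => by simp [SP.rLab]
  | .ser _ _, h, _ => by simp at h
  | .par _ _, h, _ => by simp at h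

/-- **the dual family on every pattern**: `#{r ≥ k ∧ b = 0} ≤ #{r = k}` for every `k` -/
theorem vt_le_rq : ∀ (s : V2Closure.SP) (k : ℕ),
    (Finset.univ.filter (fun y : s.Conf => k ≤ s.rLab y ∧ s.bLab y = 0)).card
      ≤ (Finset.univ.filter (fun y : s.Conf => s.rLab y = k)).card
  | .free, 0 => by decide
  | .free, 1 => by decide
  | .free, k + 2 => by
    rw [Finset.card_eq_zero.2 (Finset.filter_eq_empty_iff.2 (fun y _ => by
      have := atom_rLab_le_one .free (Or.inl rfl) y; omega))]
    exact Nat.zero_le _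
  | .pin, 0 => by decide
  | .pin, 1 => by decide
  | .pin, k + 2 => by
    rw [Finset.card_eq_zero.2 (Finset.filter_eq_empty_iff.2 (fun y _ => by
      have := atom_rLab_le_one .pin (Or.inr (Or.inl rfl)) y; omega))]
    exact Nat.zero_le _
  | .absent, 0 => by decide
  | .absent, 1 => by decide
  | .absent, k + 2 => by
    rw [Finset.card_eq_zero.2 (Finset.filter_eq_empty_iff.2 (fun y _ => by
      have := atom_rLab_le_one .absent (Or.inr (Or.inr rfl)) y; omega))]
    exact Nat.zero_le _
  | .ser s t, k => by
    rw [← dual_iff, card_rt_ser, card_ct_ser]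
    exact Nat.mul_le_mul ((dual_iff s k).2 (vt_le_rq s k)) ((dual_iff t k).2 (vt_le_rq t k))
  | .par s t, k => by
    rw [card_vt_par, card_rq_par, Finset.sum_range_succ, Nat.sub_self, card_b0_eq_r0 t]
    refine Nat.add_le_add (Finset.sum_le_sum (fun i _ => Nat.mul_le_mul (card_wq_le s i) (vt_le_rq t (k - i)))) ?_
    exact Nat.mul_le_mul (vt_le_rq s k) le_rfl

/-- **`k+1` edge-disjoint red paths are rarer than `k` edge-disjoint red paths together with a blue
path**, on every pattern of the grammar and for every `k`: `#{r ≥ k+1} ≤ #{r ≥ k ∧ b ≥ 1}` —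
anti-diagonal unimodality of the two-colour flow tail at the axis, `T(k+1, 0) ≤ T(k, 1)`. -/
theorem tail_axis_unimodal (s : V2Closure.SP) (k : ℕ) :
    (Finset.univ.filter (fun y : s.Conf => k + 1 ≤ s.rLab y)).card
      ≤ (Finset.univ.filter (fun y : s.Conf => k ≤ s.rLab y ∧ 1 ≤ s.bLab y)).card :=
  (dual_iff s k).2 (vt_le_rq s k)

/-- the same in the vocabulary of `Tail2DP2Series`: `stat s (k+1 ≤ r) ≤ stat s (k ≤ r ∧ 1 ≤ b)` -/
theorem stat_tail_axis_unimodal (s : V2Closure.SP) (k : ℕ) :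
    stat s (fun r _ => k + 1 ≤ r) ≤ stat s (fun r b => k ≤ r ∧ 1 ≤ b) :=
  tail_axis_unimodal s k

end Summit.Ventures.PercRepro2.Tail2D
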